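import Mathlib
import HarnessLib

/-!
# CongruenceSubgroupPropertySL2

Topic `Literature/NumberTheory/Automorphic`. Named literature fact(s) relocated by the gate from `Summits/Langlands/Langlands/Theorems/CapacityClassicalityHilbertIntegralOverconvergentIsCongruenceTransferCSP.lean`
(accept-time relocation of `[cite]`d propositions written inline in a Summits proposal; human ruling 2026-08-15).
Sources: SerreSL2Congruence1970.

* `Literature.NumberTheory.Automorphic.SerreSL2Congruence1970_congruenceSubgroupProperty`
-/

namespace Literature.NumberTheory.Automorphic

open scoped NumberField

/-- **Serre's congruence subgroup property for `SL₂` over the integers of a totally real number field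
of degree `≥ 2`** (J.-P. Serre, *Le problème des groupes de congruence pour SL₂*, Ann. of Math. (2) 92
(1970), 489–527: Théorème 2 with its Corollaire — for the ring of `S`-integers of a global field with
`|S| ≥ 2` the congruence kernel of `SL₂` is trivial unless the field is totally imaginary with `S` the
set of complex places; here `S` = the `d ≥ 2` real places of a totally real `F`, so every subgroup of
finite index of `SL₂(𝓞_F)` is a congruence subgroup): every finite-index subgroup `H ≤ SL₂(𝓞_F)`
contains the principal congruence subgroup `Γ(𝔪) = ker (SL₂(𝓞_F) → SL₂(𝓞_F ⧸ 𝔪))` of some non-zero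
ideal `𝔪`.  (False for `F = ℚ`: `SL₂(ℤ)` has non-congruence subgroups of finite index.)
-- TODO(general form): `S`-arithmetic `SL₂(𝓞_{K,S})`, `|S| ≥ 2`, any global field `K` not totally
-- imaginary-with-`S`-archimedean; the congruence kernel is `μ(K)` in the excluded case.
[cite: SerreSL2Congruence1970, Thm 2 and Cor.] [file NumberTheory/Automorphic/CongruenceSubgroupPropertySL2] -/
def SerreSL2Congruence1970_congruenceSubgroupProperty : Prop :=
  ∀ (F : Type) [Field F] [NumberField F] [NumberField.IsTotallyReal F],
    1 < Module.finrank ℚ F →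
    ∀ H : Subgroup (Matrix.SpecialLinearGroup (Fin 2) (𝓞 F)), H.FiniteIndex →
      ∃ 𝔪 : Ideal (𝓞 F), 𝔪 ≠ ⊥ ∧
        (Matrix.SpecialLinearGroup.map (Ideal.Quotient.mk 𝔪)).ker ≤ H

end Literature.NumberTheory.Automorphic
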